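import Mathlib.RingTheory.Localization.NormTrace
import Mathlib.RingTheory.Discriminant
import Mathlib.FieldTheory.PrimitiveElement
import Mathlib.NumberTheory.NumberField.Basic
import Mathlib.Analysis.Complex.Basic
import Literature.Analysis.Matrix.HadamardInequality
import Summits.ABC.ABC.Theorems.IsogenyGlueCongruenceDegreePrimesPolyBoundedNewPartPluecker
import Literature.NumberTheory.EllipticCurves.PastenCongruenceModulusSizeProofs
import HarnessLib

/-!
# Crux A `DegreePrimesPolyBounded` (stmt-ABC-2045), line `newpart_congruence_friability`:
# the discriminant form of the congruence bound (`η · |disc 𝕋/P|^{1/2} ≤ Hadamard`)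

(lead c18; own stub `stub_newPartPrimesOfDatum`).  See the module docstring of
`…NewPartPluecker` for the lattice identity.  Here: the analytic half.
-/

set_option linter.dupNamespace false

noncomputable section

open scoped MatrixGroups ModularForm nonZeroDivisors
open CongruenceSubgroup Matrix

namespace Summit.ABC.ABC.Theorems.DegreePrimesPolyBounded

open Literature.NumberTheory.EllipticCurves.ModularForms

/-! ### Orders: `Frac(O)` is the localisation at the non-zero integers; `disc = det(ρ_i(b_k))²` -/

section Order

variable (O : Type*) [CommRing O] [IsDomain O] [CharZero O] [Module.Free ℤ O] [Module.Finite ℤ O]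

omit [IsDomain O] [CharZero O] in
/-- In a ring free of finite rank over `ℤ`, every element divides its norm (adjugate of the
multiplication matrix). [folklore] -/
theorem dvd_algebraMap_norm (n : O) : n ∣ algebraMap ℤ O (Algebra.norm ℤ n) := by
  classical
  let b := Module.Free.chooseBasis ℤ O
  set M := Algebra.leftMulMatrix b n with hM
  refine ⟨b.equivFun.symm (M.adjugate *ᵥ b.repr 1), ?_⟩
  apply b.repr.injective
  apply DFunLike.coe_injective
  have h1 : ⇑(b.repr (b.equivFun.symm (M.adjugate *ᵥ ⇑(b.repr 1)))) = M.adjugate *ᵥ ⇑(b.repr 1) := by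
    rw [← Module.Basis.equivFun_apply, LinearEquiv.apply_symm_apply]
  rw [← Algebra.leftMulMatrix_mulVec_repr, ← hM, h1, Matrix.mulVec_mulVec, Matrix.mul_adjugate,
    Matrix.smul_mulVec, Matrix.one_mulVec, ← Algebra.norm_eq_matrix_det b,
    Algebra.algebraMap_eq_smul_one, map_smul, Finsupp.coe_smul]

/-- `Frac(O)` is the localisation of `O` at the image of `ℤ ∖ {0}` (every non-zero element divides a
non-zero integer, its norm). [folklore] -/
theorem isLocalization_algebraMapSubmonoid_int (K : Type*) [Field K] [Algebra O K]
    [IsFractionRing O K] : IsLocalization (Algebra.algebraMapSubmonoid O ℤ⁰) K := by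
  refine (IsLocalization.iff_of_le_of_exists_dvd (M := Algebra.algebraMapSubmonoid O ℤ⁰) O⁰
    ?_ ?_).mpr inferInstance
  · rintro _ ⟨m, hm, rfl⟩
    exact mem_nonZeroDivisors_of_ne_zero
      (by rw [map_ne_zero_iff _ (algebraMap ℤ O).injective_int]; exact nonZeroDivisors.ne_zero hm)
  · intro n hn
    refine ⟨algebraMap ℤ O (Algebra.norm ℤ n), ⟨_, ?_, rfl⟩, dvd_algebraMap_norm O n⟩
    exact mem_nonZeroDivisors_of_ne_zero
      (Algebra.norm_ne_zero_iff.mpr (nonZeroDivisors.ne_zero hn))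

/-- **The discriminant of an order is the square of the determinant of its complex embedding
matrix**: for a `ℤ`-basis `b` of `O` and a fraction field `K` of characteristic zero there are ring
maps `ρ_j : O → ℂ` (the embeddings of `K`, indexed by the basis index set) with
`det(ρ_j(b_i))² = disc_ℤ(b)` in `ℂ`. [folklore] -/
theorem exists_ringHom_det_sq_eq_discr_of_isFractionRing (K : Type*) [Field K] [CharZero K]
    [Algebra O K] [IsFractionRing O K] {ι : Type*} [Fintype ι] [DecidableEq ι]
    (b : Module.Basis ι ℤ O) :
    ∃ ρ : ι → (O →+* ℂ), (Matrix.of fun i j ↦ ρ j (b i)).det ^ 2 = (Algebra.discr ℤ b : ℂ) := by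
  haveI : IsLocalization (Algebra.algebraMapSubmonoid O ℤ⁰) K :=
    isLocalization_algebraMapSubmonoid_int O K
  let bQ : Module.Basis ι ℚ K := b.localizationLocalization ℚ ℤ⁰ K
  haveI : FiniteDimensional ℚ K := Module.Finite.of_basis bQ
  haveI : Algebra.IsSeparable ℚ K := Algebra.IsSeparable.of_integral ℚ K
  have hcard : Fintype.card ι = Fintype.card (K →ₐ[ℚ] ℂ) := by
    rw [AlgHom.card, Module.finrank_eq_card_basis bQ]
  let e : ι ≃ (K →ₐ[ℚ] ℂ) := Fintype.equivOfCardEq hcard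
  refine ⟨fun j ↦ (e j).toRingHom.comp (algebraMap O K), ?_⟩
  have h := Algebra.discr_eq_det_embeddingsMatrixReindex_pow_two ℚ ℂ bQ e
  have hd : Algebra.discr ℚ bQ = algebraMap ℤ ℚ (Algebra.discr ℤ b) :=
    Algebra.discr_localizationLocalization ℤ ℤ⁰ K b
  rw [hd, eq_intCast, map_intCast] at h
  rw [h]
  congr 2
  ext i j
  simp [bQ, Algebra.embeddingsMatrixReindex, Algebra.embeddingsMatrix,
    Module.Basis.localizationLocalization_apply]

/-- The same with `K = Frac(O)`. [folklore] -/
theorem exists_ringHom_det_sq_eq_discr {ι : Type*} [Fintype ι] [DecidableEq ι]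
    (b : Module.Basis ι ℤ O) :
    ∃ ρ : ι → (O →+* ℂ), (Matrix.of fun i j ↦ ρ j (b i)).det ^ 2 = (Algebra.discr ℤ b : ℂ) := by
  haveI : CharZero (FractionRing O) :=
    charZero_of_injective_algebraMap (IsFractionRing.injective O (FractionRing O))
  exact exists_ringHom_det_sq_eq_discr_of_isFractionRing O (FractionRing O) b

end Order

/-! ### A block-determinant identity for `Option`-indexed matrices -/

/-- Multiplying the rows `some _` of an `Option`-indexed square matrix on the left by a square
matrix `E` (leaving the row `none` alone) multiplies the determinant by `det E`. [folklore] -/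
theorem det_of_elim_sum_mul {ι : Type*} [Fintype ι] [DecidableEq ι] {S : Type*} [CommRing S]
    (E : Matrix ι ι S) (M : Matrix (Option ι) (Option ι) S) :
    (Matrix.of fun (i j : Option ι) ↦ i.elim (M none j) fun i ↦ ∑ k, E i k * M (some k) j).det =
      E.det * M.det := by
  let Et : Matrix (Option ι) (Option ι) S :=
    Matrix.of fun (i k : Option ι) ↦ i.elim (k.elim 1 fun _ ↦ 0) fun i ↦ k.elim 0 fun k ↦ E i k
  have hmul : (Matrix.of fun (i j : Option ι) ↦ i.elim (M none j) fun i ↦ ∑ k, E i k * M (some k) j)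
      = Et * M := by
    ext i j
    cases i with
    | none => simp [Et, Matrix.mul_apply, Fintype.sum_option]
    | some i => simp [Et, Matrix.mul_apply, Fintype.sum_option]
  have hEt : Et.det = E.det := by
    have hre : Et = Matrix.reindex (Equiv.optionEquivSumPUnit.{0} ι).symm
        (Equiv.optionEquivSumPUnit.{0} ι).symm
          (Matrix.fromBlocks E 0 0 (1 : Matrix PUnit.{1} PUnit.{1} S)) := by
      ext i k
      cases i with
      | none => cases k with
        | none => simp [Et]
        | some k => simp [Et]
      | some i => cases k with
        | none => simp [Et]
        | some k => simp [Et]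
    rw [hre, Matrix.det_reindex_self, Matrix.det_fromBlocks_zero₂₁, Matrix.det_one, mul_one]
  rw [hmul, Matrix.det_mul, hEt]

/-! ### The discriminant form of the congruence bound (abstract) -/

/-- **`η² · |disc| ≤ Hadamard²` (abstract form).**  Let `χ₀ : R → ℤ` be a ring map, `P` an ideal with
`R ⧸ P` a domain of characteristic `0`, free of finite rank over `ℤ` with basis `b`, and `x` a family of
`rank + 1` elements of `R` whose values at every complex point of `Spec R` are bounded by `H_j`.
If the augmented determinant of `x` is non-zero (i.e. the `x_j` are independent modulo
`P ∩ ker χ₀`), then `η² · |disc_ℤ(b)| ≤ ∏_j ((rank + 1) · H_j²)`, `η = #R/(ker χ₀ + P)`: combine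
`η ∣ det` (`congruenceModulus_dvd_det_augmented`), `det_ℂ[ρ_i(x_j); χ₀(x_j)] = det(ρ_i(b_k)) · det`
(`det_of_elim_sum_mul`), `|det(ρ_i(b_k))|² = |disc|` (`exists_ringHom_det_sq_eq_discr`) and
Hadamard's inequality (`Literature.Analysis.Matrix.norm_det_sq_le_of_entry_le`). [folklore] -/
theorem congruenceModulus_sq_mul_discr_le {R : Type*} [CommRing R] (χ₀ : R →+* ℤ) (P : Ideal R)
    [IsDomain (R ⧸ P)] [CharZero (R ⧸ P)] [Module.Free ℤ (R ⧸ P)] [Module.Finite ℤ (R ⧸ P)]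
    {ι : Type*} [Fintype ι] [DecidableEq ι] (b : Module.Basis ι ℤ (R ⧸ P)) (x : Option ι → R)
    (H : Option ι → ℝ) (hH : ∀ j, ∀ ρ : R →+* ℂ, ‖ρ (x j)‖ ≤ H j)
    (hx : (Matrix.of fun (i j : Option ι) ↦ i.elim (χ₀ (x j))
      fun i ↦ b.repr (Ideal.Quotient.mk P (x j)) i).det ≠ 0) :
    (congruenceModulus (RingHom.ker χ₀) P : ℝ) ^ 2 * |(Algebra.discr ℤ b : ℝ)| ≤
      ∏ j : Option ι, ((Fintype.card (Option ι) : ℝ) * H j ^ 2) := by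
  set A : Matrix (Option ι) (Option ι) ℤ := Matrix.of fun (i j : Option ι) ↦ i.elim (χ₀ (x j))
      fun i ↦ b.repr (Ideal.Quotient.mk P (x j)) i with hA
  -- η ≤ |det A|
  have hη : (congruenceModulus (RingHom.ker χ₀) P : ℝ) ≤ |(A.det : ℝ)| := by
    have h := congruenceModulus_le_natAbs_det_augmented χ₀ P b x hx
    calc (congruenceModulus (RingHom.ker χ₀) P : ℝ) ≤ (A.det.natAbs : ℝ) := by exact_mod_cast h
      _ = |(A.det : ℝ)| := by rw [Nat.cast_natAbs, Int.cast_abs]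
  -- complex embeddings with det² = disc
  obtain ⟨ρ, hρ⟩ := exists_ringHom_det_sq_eq_discr (R ⧸ P) b
  let E : Matrix ι ι ℂ := Matrix.of fun i k ↦ ρ i (b k)
  have hE : E.det ^ 2 = (Algebra.discr ℤ b : ℂ) := by
    have hT : E = (Matrix.of fun i j ↦ ρ j (b i)).transpose := rfl
    rw [hT, Matrix.det_transpose]
    exact hρ
  -- the complex matrix `[ρ_i(x_j); χ₀(x_j)]`
  let Mc : Matrix (Option ι) (Option ι) ℂ := Matrix.of fun (i j : Option ι) ↦
    i.elim ((χ₀ (x j) : ℂ)) fun i ↦ ρ i (Ideal.Quotient.mk P (x j))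
  have hMc : Mc = Matrix.of fun (i j : Option ι) ↦ i.elim ((A.map (Int.castRingHom ℂ)) none j)
      fun i ↦ ∑ k, E i k * (A.map (Int.castRingHom ℂ)) (some k) j := by
    ext i j
    cases i with
    | none => simp [Mc, hA]
    | some i =>
      simp only [Mc, hA, Matrix.of_apply, Option.elim_some, Matrix.map_apply, eq_intCast, E]
      conv_lhs => rw [← b.sum_repr (Ideal.Quotient.mk P (x j))]
      rw [map_sum]
      refine Finset.sum_congr rfl fun k _ ↦ ?_
      rw [map_zsmul, zsmul_eq_mul, mul_comm]
  have hdet : Mc.det = E.det * (A.det : ℂ) := by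
    rw [hMc, det_of_elim_sum_mul]
    congr 1
    rw [← eq_intCast (Int.castRingHom ℂ), RingHom.map_det, RingHom.mapMatrix_apply]
  -- Hadamard on the transpose (column bounds `H j`)
  have hHad := Literature.Analysis.Matrix.norm_det_sq_le_of_entry_le Mc.transpose H (fun j i ↦ by
    rw [Matrix.transpose_apply]
    cases i with
    | none => simpa [Mc] using hH j ((Int.castRingHom ℂ).comp χ₀)
    | some i => simpa [Mc] using hH j ((ρ i).comp (Ideal.Quotient.mk P)))
  rw [Matrix.det_transpose, hdet, norm_mul, mul_pow, Complex.norm_intCast] at hHad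
  have hEn : ‖E.det‖ ^ 2 = |(Algebra.discr ℤ b : ℝ)| := by
    rw [← norm_pow, hE, Complex.norm_intCast]
  rw [hEn] at hHad
  -- assemble
  calc (congruenceModulus (RingHom.ker χ₀) P : ℝ) ^ 2 * |(Algebra.discr ℤ b : ℝ)|
      ≤ |(A.det : ℝ)| ^ 2 * |(Algebra.discr ℤ b : ℝ)| := by
        gcongr
    _ = |(Algebra.discr ℤ b : ℝ)| * |(A.det : ℝ)| ^ 2 := mul_comm _ _
    _ ≤ ∏ j : Option ι, ((Fintype.card (Option ι) : ℝ) * H j ^ 2) := hHad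

/-! ### The Hecke ring -/

variable {N : ℕ} [NeZero N] {k : ℤ}

/-- **Discriminant form of the congruence bound for the Hecke ring.**  Let `f ∈ S_k(Γ₀(N))` be a
non-zero form with integral eigenvalues `χ_f`, `P` a minimal prime of `𝕋 = anemicHeckeRing N k`
(a Galois orbit of eigen-systems; `𝕋 ⧸ P` is an order in a number field), `b` a `ℤ`-basis of
`𝕋 ⧸ P` indexed by `ι` (`#ι = rank_ℤ 𝕋 ⧸ P = d`), and `x_j` (`j : Option ι`) `d + 1` Hecke
operators with `|ρ(x_j)| ≤ H_j` at every complex point `ρ` of `Spec 𝕋`.  If the augmented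
determinant `det[b-coords(x_j mod P); χ_f(x_j)]` is non-zero, then
`η_f(P)² · |disc(𝕋 ⧸ P)| ≤ ∏_j ((d + 1) · H_j²)` — i.e. `η_f(P) ≤ (d+1)^{(d+1)/2} ∏ H_j / |disc|^{1/2}`:
the exponential loss of the known regimes (`log η ≤ 3 d log N`) is exactly the deficiency of the
discriminant of the Hecke order against the Hadamard bound of `d + 1` short operators.
[cite: PastenShimura2024, Prop. 5.4 p. 17] -/
theorem heckeCongruenceModulus_sq_mul_discr_le {f : CuspForm (Gamma0 N) k}
    (hf : HasIntegralEigenvalues f) (hf0 : f ≠ 0) {P : Ideal (anemicHeckeRing N k)}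
    (hP : P ∈ minimalPrimes (anemicHeckeRing N k))
    {ι : Type*} [Fintype ι] [DecidableEq ι] (b : Module.Basis ι ℤ (anemicHeckeRing N k ⧸ P))
    (x : Option ι → anemicHeckeRing N k) (H : Option ι → ℝ)
    (hH : ∀ j, ∀ ρ : anemicHeckeRing N k →+* ℂ, ‖ρ (x j)‖ ≤ H j)
    (hx : (Matrix.of fun (i j : Option ι) ↦ i.elim (intEigencharacter hf hf0 (x j))
      fun i ↦ b.repr (Ideal.Quotient.mk P (x j)) i).det ≠ 0) :
    (heckeCongruenceModulus f P : ℝ) ^ 2 * |(Algebra.discr ℤ b : ℝ)| ≤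
      ∏ j : Option ι, ((Fintype.card (Option ι) : ℝ) * H j ^ 2) := by
  haveI : P.IsPrime := hP.1.1
  haveI : Module.Finite ℤ (anemicHeckeRing N k ⧸ P) := finite_quotient_anemicHeckeRing P
  haveI : Module.Free ℤ (anemicHeckeRing N k ⧸ P) := free_quotient_of_mem_minimalPrimes hP
  haveI : CharZero (anemicHeckeRing N k ⧸ P) := charZero_quotient_of_mem_minimalPrimes hP
  rw [heckeCongruenceModulus, eigenIdeal_eq_ker_intEigencharacter hf hf0]
  exact congruenceModulus_sq_mul_discr_le _ P b x H hH hx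


/-- **Registered sub-goal `stub_discriminantCongruenceBound` of crux stmt-ABC-2045** (line
`newpart_congruence_friability`, lead c18; the analytic half of the E-free transfer behind the bet
`stub_newPartPrimesOfDatum`): for a minimal prime `P` of `𝕋 = anemicHeckeRing N k` with `ℤ`-basis
`b : Fin d → 𝕋 ⧸ P` and `d + 1` Hecke operators `x_j` of heights `≤ H_j` at every complex point of
`Spec 𝕋`, independent modulo `P ∩ 𝕀_f` (non-zero augmented determinant),
`η_f(P)² · |disc_ℤ(b)| ≤ ∏_j ((d + 1) · H_j²)` (`heckeCongruenceModulus_sq_mul_discr_le`).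
[cite: PastenShimura2024, Prop. 5.4 p. 17] -/
theorem stub_discriminantCongruenceBound :
    ∀ (N : ℕ) [NeZero N] (k : ℤ) (f : CuspForm (Gamma0 N) k) (hf : HasIntegralEigenvalues f)
    (hf0 : f ≠ 0) (P : Ideal (anemicHeckeRing N k)), P ∈ minimalPrimes (anemicHeckeRing N k) →
    ∀ (d : ℕ) (b : Module.Basis (Fin d) ℤ (anemicHeckeRing N k ⧸ P))
    (x : Option (Fin d) → anemicHeckeRing N k) (H : Option (Fin d) → ℝ),
    (∀ j, ∀ ρ : anemicHeckeRing N k →+* ℂ, ‖ρ (x j)‖ ≤ H j) →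
    (Matrix.of fun (i j : Option (Fin d)) ↦ i.elim (intEigencharacter hf hf0 (x j))
      fun i ↦ b.repr (Ideal.Quotient.mk P (x j)) i).det ≠ 0 →
    (heckeCongruenceModulus f P : ℝ) ^ 2 * |(Algebra.discr ℤ b : ℝ)| ≤
      ∏ j : Option (Fin d), (((d + 1 : ℕ) : ℝ) * H j ^ 2) := by
  intro N _ k f hf hf0 P hP d b x H hH hx
  have h := heckeCongruenceModulus_sq_mul_discr_le hf hf0 hP b x H hH hx
  simpa only [Fintype.card_option, Fintype.card_fin] using h

end Summit.ABC.ABC.Theorems.DegreePrimesPolyBounded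

end
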